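import Summits.AtomisticToContinuum.HydrodynamicLimit.Theorems.RelayRaceLocalityNearConstantShortTimeHLEntropyPrice
import Summits.AtomisticToContinuum.HydrodynamicLimit.Theorems.RelayRaceLocalityNearConstantShortTimeHLStaticsKL
import Summits.AtomisticToContinuum.HydrodynamicLimit.Theorems.RelayRaceLocalityNearConstantShortTimeHLLogProfileObsBounds
import Summits.AtomisticToContinuum.HydrodynamicLimit.Theorems.RelayRaceLocalityNearConstantShortTimeHLFluctuationTools
import Summits.AtomisticToContinuum.HydrodynamicLimit.Theorems.RelayRaceLocalityNearConstantShortTimeHLMeansPinStatics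
import HarnessLib

/-!
# Crux `NearConstantShortTimeHL` (stmt-AtomisticToContinuum-12502), line `small-tilt-domination`:
# stub `entropy_price_package` (level 1b of the Grönwall assembly)

Support file for the crux `…Theses.RelayRaceLocality.NearConstantShortTimeHL` (route: Yau's relative-entropy method,
Grönwall assembly `stub_dynamic`; lead c4), registered stub **`entropy_price_package`**: along a classical hard-sphere
Euler solution with packing `ρσ³ < η₀` on `[0, t] × 𝕋³` (analytic equation of state on `[0, η₀)`), for the canonical
laws `P_N` of the Euler-matched local Gibbs profile at time `0` evolved by the hard-sphere flows `Φ_N`, the PRICE of the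
energy-weighted mesoscale fluctuation is paid by the relative entropy: for every `κ > 0`, eventually in `N` and
uniformly in `r ∈ [0, t]`,

`E_{P_N}[fluctuationE_{ℓ_N}(ρ_r, θ_r, u_r) ∘ Φ_r] ≤ γ⁻¹ · ((m^{st}(r) − E_{P_N}[X_r ∘ Φ_r]) + κ)`,

together with the integrability of `X_r ∘ Φ_r` (the log-profile observable) and of the fluctuation along the flow.

Route (pure glue of landed facts):

* STATICS — `klDiv_div_le_of_static` (…StaticsKL) with `S = [0, t]`, `p` / `q_r` the matched local Gibbs profiles at
  times `0` / `r` (continuous positive activities `ρ e^{g_σ(ρ)}` in the band, `log_localGibbsProfile_matched`,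
  partition positivity transfer `canonicalPartition_localGibbs_pos_of_ne_zero`), the static inputs `hπ₀`, `hπ`,
  `hm₀`, the isentropy identity, and the integrability of `X_r ∘ Φ_r` (`integrable_logProfileObs_flow`,
  `logProfileObs_eq_integral`): eventually `KL_r < ∞` and `KL_r / n ≤ D_N(r) + κ/2` for all `r ∈ [0, t]`;
* PRICE — the entropy inequality for the unbounded nonnegative functional `G = fluctuationE_{ℓ_N}(ρ_r, θ_r, u_r)`
  (`integral_comp_flow_le_klDiv_add_log_of_nonneg`, …EntropyPrice) with `c = γ n`, the exponential-moment input at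
  slack `κ/2`, `G` measurable (`measurable_fluctuationE_clamp`) and `G ∘ Φ_r ≤ 2 + K ∘ Φ_r` integrable
  (`fluctuationE_le`; `ℓ_N = n^{-1/4} ∈ (0, 1/2)` eventually); the reference law is a probability measure because
  `KL_r < ∞` forces it to be nonzero (law dichotomy `particleLaw_canonicalDensity_zero_or_prob`);
* arithmetic: `(γn)⁻¹ (KL_r + κn/2) = γ⁻¹ (KL_r/n + κ/2) ≤ γ⁻¹ (D_N(r) + κ)`.

Helpers are prefixed `xA_`. No definitions, no named facts.
References: H.-T. Yau, Lett. Math. Phys. 22 (1991) §2; C. Kipnis – C. Landim, *Scaling Limits of Interacting Particle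
Systems* (1999), Appendix 1 §8.
-/

noncomputable section

namespace Summit.AtomisticToContinuum.HydrodynamicLimit.Theorems.NearConstantShortTimeHL

open scoped BigOperators ENNReal Topology
open MeasureTheory Set Filter
open Literature.MathematicalPhysics.KineticTheory Literature.Analysis.FluidPDE Literature.Analysis.FunctionSpaces

/-! ## Helpers -/

/-- **The mesoscale radius is eventually admissible.** Along `n_N → ∞`: eventually `n_N ≠ 0` and
`0 < ℓ_N = n_N^{-1/4} < 1/2` (`x ↦ x^{-1/4} → 0` at `+∞`). [folklore] -/
theorem xA_mesoRadius_eventually {n : ℕ → ℕ} (hn : Tendsto n atTop atTop) :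
    ∀ᶠ N in atTop, n N ≠ 0 ∧ 0 < mesoRadius (n N) ∧ mesoRadius (n N) < 1 / 2 := by
  have hcast : Tendsto (fun N => (n N : ℝ)) atTop atTop := tendsto_natCast_atTop_atTop.comp hn
  have hlim : Tendsto (fun N => mesoRadius (n N)) atTop (nhds 0) := by
    have h := (tendsto_rpow_neg_atTop (by norm_num : (0 : ℝ) < 1 / 4)).comp hcast
    simpa only [Function.comp_def, mesoRadius] using h
  have h1 : ∀ᶠ N in atTop, 1 ≤ n N := hn.eventually_ge_atTop 1
  have h2 : ∀ᶠ N in atTop, mesoRadius (n N) < 1 / 2 := hlim.eventually (gt_mem_nhds (by norm_num))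
  filter_upwards [h1, h2] with N hN1 hN2
  have hpos : (0 : ℝ) < n N := by exact_mod_cast hN1
  refine ⟨by omega, ?_, hN2⟩
  unfold mesoRadius
  exact Real.rpow_pos_of_pos hpos _

/-- **A reference law of finite relative entropy is a probability measure.** A canonical hard-sphere law with a
nonnegative profile is either zero or a probability measure (`particleLaw_canonicalDensity_zero_or_prob`); if the
push-forward `(Φ_r)_* P` of a probability law has finite relative entropy with respect to it, it is absolutely
continuous with respect to it, so the reference law is not zero. [folklore] -/
theorem xA_isProbabilityMeasure_of_klDiv_ne_top {ε : ℝ} {n : ℕ} (Φ : HardSphereFlow (Torus.geometry (Fin 3)) ε n)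
    (P : Measure (Config n (Fin 3) T3)) [IsProbabilityMeasure P] (r : ℝ) {f₀ : T3 × V3 → ℝ} (hf : ∀ y, 0 ≤ f₀ y)
    (hKL : InformationTheory.klDiv (Φ.lawAt P r)
      (particleLaw Φ (canonicalDensity (Torus.geometry (Fin 3)) ε n f₀)) ≠ ⊤) :
    IsProbabilityMeasure (particleLaw Φ (canonicalDensity (Torus.geometry (Fin 3)) ε n f₀)) := by
  rcases NearConstantShortTimeHLNegative.particleLaw_canonicalDensity_zero_or_prob Φ hf with h | h
  · exfalso
    have hac := (InformationTheory.klDiv_ne_top_iff.1 hKL).1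
    rw [h, Measure.absolutelyContinuous_zero_iff] at hac
    haveI : IsProbabilityMeasure (Φ.lawAt P r) := by
      rw [HardSphereFlow.lawAt_eq]
      exact Measure.isProbabilityMeasure_map (Φ.measurable_flow r).aemeasurable
    exact IsProbabilityMeasure.ne_zero (Φ.lawAt P r) hac
  · exact h

/-- **Arithmetic of the price.** `k, n, γ > 0`-bookkeeping: if `k / n ≤ D + κ/2` then
`(γ n)⁻¹ (k + κ/2 · n) ≤ γ⁻¹ (D + κ)`. [folklore] -/
theorem xA_price_arith {γ ν k D κ F' : ℝ} (hγ : 0 < γ) (hν : 0 < ν) (hle : k / ν ≤ D + κ / 2)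
    (hF : F' ≤ (γ * ν)⁻¹ * (k + κ / 2 * ν)) : F' ≤ γ⁻¹ * (D + κ) := by
  have h1 : (γ * ν)⁻¹ * (k + κ / 2 * ν) = γ⁻¹ * (k / ν + κ / 2) := by
    field_simp
  rw [h1] at hF
  refine hF.trans (mul_le_mul_of_nonneg_left ?_ (inv_nonneg.2 hγ.le))
  linarith

/-! ## The registered stub -/

/-- **Registered stub `entropy_price_package` (level 1b of the Grönwall assembly): entropy price + statics.** Along a
classical hard-sphere Euler solution with packing `< η₀` on `[0, t] × 𝕋³` (analytic equation of state on `[0, η₀)`),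
for the canonical laws `P_N` of the Euler-matched local Gibbs profile at time `0` (probability measures), given the
static inputs (pressure limits at time `0` and uniformly along the solution, convergence of the mean of the
log-profile observable at time `0`, the isentropy identity `m^{st}(0) − π₀ = m^{st}(r) − π^{st}(r)`) and the
exponential-moment bound `∫ exp(γ n fluctuationE_{ℓ_N}) dQ^r_N ≤ e^{κ n}` (every `κ > 0`, eventually, uniformly in
`r`): for every `κ > 0`, eventually in `N`, for all `r ∈ [0, t]`, `X_r ∘ Φ_r` and `fluctuationE_{ℓ_N} ∘ Φ_r` are
`P_N`-integrable and `E_{P_N}[fluctuationE_{ℓ_N} ∘ Φ_r] ≤ γ⁻¹ ((m^{st}(r) − E_{P_N}[X_r ∘ Φ_r]) + κ)` — the entropy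
inequality `E_P[G ∘ Φ_r] ≤ (γn)⁻¹ (KL((Φ_r)_* P_N ‖ Q^r_N) + κn/2)` combined with Yau's statics bookkeeping
`KL/n ≤ (m^{st}(r) − E[X_r ∘ Φ_r]) + κ/2`. [cite: Yau1991, §2] -/
theorem entropy_price_package : ∀ {η₀ : ℝ} {F : ℝ → ℝ}, 0 < η₀ → AnalyticOnNhd ℝ F (Set.Ioo (-η₀) η₀) → Set.EqOn hsExcessFreeEnergy F (Set.Ico 0 η₀) → ∀ {σ T : ℝ}, 0 < σ → ∀ {ρ θ : ℝ → T3 → ℝ} {u : ℝ → T3 → V3}, IsHardSphereEulerSolution σ T ρ u θ → ∀ {t : ℝ}, t ∈ Set.Ico 0 T → (∀ s ∈ Set.Icc 0 t, ∀ x, ρ s x * σ ^ 3 < η₀) → ∀ {ε : ℕ → ℝ} {n : ℕ → ℕ}, Tendsto n atTop atTop → (∀ N, 0 < ε N) → ∀ (Φ : (N : ℕ) → HardSphereFlow (Torus.geometry (Fin 3)) (ε N) (n N)) (P : (N : ℕ) → Measure (Config (n N) (Fin 3) T3)), (∀ N, P N = particleLaw (Φ N) (canonicalDensity (Torus.geometry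 (Fin 3)) (ε N) (n N) (localGibbsProfile (fun x => ρ 0 x * Real.exp (gChem σ (ρ 0 x))) (u 0) (θ 0)))) → (∀ N, IsProbabilityMeasure (P N)) → ∀ {π₀ : ℝ} {πst : ℝ → ℝ}, Tendsto (fun N => (n N : ℝ)⁻¹ * Real.log (canonicalPartition (Torus.geometry (Fin 3)) (ε N) (n N) (localGibbsProfile (fun x => ρ 0 x * Real.exp (gChem σ (ρ 0 x))) (u 0) (θ 0)))) atTop (nhds π₀) → TendstoUniformlyOn (fun N r => (n N : ℝ)⁻¹ * Real.log (canonicalPartition (Torus.geometry (Fin 3)) (ε N) (n N) (localGibbsProfile (fun x => ρ r x * Real.exp (gChem σ (ρ r x))) (u r) (θ r)))) πst atTop (Set.Icc 0 t) → Tendsto (fun N => ∫ z, logProfileObs σ ρ θ u 0 z ∂(P N)) atTop (nhds (∫ x, ρ 0 x * (Real.log (ρ 0 x) + gChem σ (ρ 0 x) - 3 / 2 * Real.log (2 * Real.pi * θ 0 x) - 3 / 2))) → (∀ᶠ N : ℕ in atTop, Integrable (fun z => logProfileObs σ ρ θ u 0 z) (P N)) → (∀ r ∈ Set.Icc 0 t,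 (∫ x, ρ 0 x * (Real.log (ρ 0 x) + gChem σ (ρ 0 x) - 3 / 2 * Real.log (2 * Real.pi * θ 0 x) - 3 / 2)) - π₀ = (∫ x, ρ r x * (Real.log (ρ r x) + gChem σ (ρ r x) - 3 / 2 * Real.log (2 * Real.pi * θ r x) - 3 / 2)) - πst r) → ∀ {γ : ℝ}, 0 < γ → (∀ κ : ℝ, 0 < κ → ∀ᶠ N : ℕ in atTop, ∀ r ∈ Set.Icc 0 t, ∫⁻ w, ENNReal.ofReal (Real.exp (γ * (n N : ℝ) * fluctuationE (mesoRadius (n N)) (ρ r) (θ r) (u r) w)) ∂(particleLaw (Φ N) (canonicalDensity (Torus.geometry (Fin 3)) (ε N) (n N) (localGibbsProfile (fun x => ρ r x * Real.exp (gChem σ (ρ r x))) (u r) (θ r)))) ≤ ENNReal.ofReal (Real.exp (κ * (n N : ℝ)))) → ∀ κ : ℝ, 0 < κ → ∀ᶠ N : ℕ in atTop, ∀ r ∈ Set.Icc 0 t, Integrable (fun z => logProfileObs σ ρ θ u r ((Φ N).flow r z)) (P N) ∧ Integrable (fun z => fluctuationE (mesoRadius (n N)) (ρ r) (θ r) (u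 r) ((Φ N).flow r z)) (P N) ∧ ∫ z, fluctuationE (mesoRadius (n N)) (ρ r) (θ r) (u r) ((Φ N).flow r z) ∂(P N) ≤ γ⁻¹ * (((∫ x, ρ r x * (Real.log (ρ r x) + gChem σ (ρ r x) - 3 / 2 * Real.log (2 * Real.pi * θ r x) - 3 / 2)) - ∫ z, logProfileObs σ ρ θ u r ((Φ N).flow r z) ∂(P N)) + κ) := by
  intro η₀ F hη₀ hFa hEqF σ T hσ ρ θ u hE t ht hband ε n hn hε Φ P hPdef hP π₀ πst hπ₀ hπ hm₀ hm₀i hiso γ hγ hSt2 κ hκ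
  ------------------------------------------------------------------
  -- Step 0: the data along the solution
  ------------------------------------------------------------------
  have hfex : ContDiffOn ℝ ((⊤ : ℕ∞) : WithTop ℕ∞) hsExcessFreeEnergy (Ioo 0 η₀) :=
    (hFa.contDiffOn_of_completeSpace.mono (Ioo_subset_Ioo (by linarith) le_rfl)).congr
      fun r hr => hEqF ⟨hr.1.le, hr.2⟩
  have hσ3 : 0 < σ ^ 3 := pow_pos hσ 3
  have hsT : ∀ s ∈ Icc 0 t, s ∈ Ico 0 T := fun s hs => ⟨hs.1, hs.2.trans_lt ht.2⟩
  have h0t : (0 : ℝ) ∈ Icc 0 t := ⟨le_rfl, ht.1⟩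
  have hρc : ∀ s ∈ Icc 0 t, Continuous (ρ s) := fun s hs =>
    (hE.smooth_density.isSmooth_slice (hsT s hs)).continuous
  have hθc : ∀ s ∈ Icc 0 t, Continuous (θ s) := fun s hs =>
    (hE.smooth_temperature.isSmooth_slice (hsT s hs)).continuous
  have huc : ∀ s ∈ Icc 0 t, Continuous (u s) := fun s hs =>
    (hE.smooth_velocity.isSmooth_slice (hsT s hs)).continuous
  have hρ0 : ∀ s ∈ Icc 0 t, ∀ x, 0 < ρ s x := fun s hs => hE.density_pos s (hsT s hs)
  have hθ0 : ∀ s ∈ Icc 0 t, ∀ x, 0 < θ s x := fun s hs => hE.temperature_pos s (hsT s hs)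
  -- the matched activities `ρ_s e^{g_σ(ρ_s)}` are continuous (the band lies in `(0, η₀)`) and positive
  have hac : ∀ s ∈ Icc 0 t, Continuous fun x => ρ s x * Real.exp (gChem σ (ρ s x)) := by
    intro s hs
    have hbs : ∀ x, ρ s x * σ ^ 3 ∈ Ioo 0 η₀ := fun x => ⟨mul_pos (hρ0 s hs x) hσ3, hband s hs x⟩
    have hηc : Continuous fun x => ρ s x * σ ^ 3 := (hρc s hs).mul continuous_const
    have hg : Continuous fun x => gChem σ (ρ s x) := by
      show Continuous fun x => hsExcessFreeEnergy (ρ s x * σ ^ 3) +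
        ρ s x * σ ^ 3 * deriv hsExcessFreeEnergy (ρ s x * σ ^ 3)
      exact (hfex.continuousOn.comp_continuous hηc hbs).add (hηc.mul
        ((hfex.continuousOn_deriv_of_isOpen isOpen_Ioo (by simp)).comp_continuous hηc hbs))
    exact (hρc s hs).mul hg.rexp
  have ha0 : ∀ s ∈ Icc 0 t, ∀ x, 0 < ρ s x * Real.exp (gChem σ (ρ s x)) := fun s hs x =>
    mul_pos (hρ0 s hs x) (Real.exp_pos _)
  -- the matched local Gibbs profiles: measurable, positive, with positive partition functions
  have hpm : Measurable (localGibbsProfile (fun x => ρ 0 x * Real.exp (gChem σ (ρ 0 x))) (u 0) (θ 0)) :=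
    measurable_localGibbsProfile (hac 0 h0t) (hθc 0 h0t) (huc 0 h0t)
  have hqm : ∀ r ∈ Icc 0 t,
      Measurable (localGibbsProfile (fun x => ρ r x * Real.exp (gChem σ (ρ r x))) (u r) (θ r)) := fun r hr =>
    measurable_localGibbsProfile (hac r hr) (hθc r hr) (huc r hr)
  have hp0 : ∀ y, 0 < localGibbsProfile (fun x => ρ 0 x * Real.exp (gChem σ (ρ 0 x))) (u 0) (θ 0) y := fun y =>
    mul_pos (ha0 0 h0t _) (localMaxwellian_pos one_pos (hθ0 0 h0t _) _ _)
  have hq0 : ∀ r ∈ Icc 0 t, ∀ y,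
      0 < localGibbsProfile (fun x => ρ r x * Real.exp (gChem σ (ρ r x))) (u r) (θ r) y := fun r hr y =>
    mul_pos (ha0 r hr _) (localMaxwellian_pos one_pos (hθ0 r hr _) _ _)
  have hZ : ∀ N, ∀ r ∈ Icc 0 t, canonicalPartition (Torus.geometry (Fin 3)) (ε N) (n N)
      (localGibbsProfile (fun x => ρ 0 x * Real.exp (gChem σ (ρ 0 x))) (u 0) (θ 0)) ≠ 0 →
      0 < canonicalPartition (Torus.geometry (Fin 3)) (ε N) (n N)
        (localGibbsProfile (fun x => ρ r x * Real.exp (gChem σ (ρ r x))) (u r) (θ r)) := fun N r hr hZN =>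
    canonicalPartition_localGibbs_pos_of_ne_zero (hac 0 h0t) (hθc 0 h0t) (huc 0 h0t) (ha0 0 h0t) (hθ0 0 h0t)
      (hac r hr) (hθc r hr) (huc r hr) (ha0 r hr) (hθ0 r hr) hZN
  -- the log-profiles
  have hΛA := log_localGibbsProfile_matched (u := u 0) (gChem σ) (hρ0 0 h0t) (hθ0 0 h0t)
  have hΛB : ∀ r ∈ Icc 0 t, ∀ y : T3 × V3,
      Real.log (localGibbsProfile (fun x => ρ r x * Real.exp (gChem σ (ρ r x))) (u r) (θ r) y) =
        Real.log (ρ r y.1) + gChem σ (ρ r y.1) - 3 / 2 * Real.log (2 * Real.pi * θ r y.1) -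
          ‖y.2 - u r y.1‖ ^ 2 / (2 * θ r y.1) := fun r hr =>
    log_localGibbsProfile_matched (gChem σ) (hρ0 r hr) (hθ0 r hr)
  ------------------------------------------------------------------
  -- Step 1: integrability along the flow (every `N`, every `r ∈ [0, t]`)
  ------------------------------------------------------------------
  have hInt : ∀ N, (∀ r : ℝ, Integrable (fun z => kineticPP ((Φ N).flow r z)) (P N)) ∧
      ∀ r ∈ Icc 0 t, Integrable (fun z => logProfileObs σ ρ θ u r ((Φ N).flow r z)) (P N) := by
    intro N
    obtain ⟨-, hK, hX⟩ := integrable_logProfileObs_flow hη₀ hFa hEqF hσ hE ht hband (hac 0 h0t) (hθc 0 h0t)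
      (huc 0 h0t) (fun x => (ha0 0 h0t x).le) (hθ0 0 h0t) (Φ N)
    rw [hPdef N]
    exact ⟨hK, fun r hr => (hX r hr).2⟩
  ------------------------------------------------------------------
  -- Step 2: STATICS (`klDiv_div_le_of_static` at slack `κ / 2`)
  ------------------------------------------------------------------
  have hm₀i' : ∀ᶠ N : ℕ in atTop, Integrable (fun z => ∫ y, (Real.log (ρ 0 y.1) + gChem σ (ρ 0 y.1) -
      3 / 2 * Real.log (2 * Real.pi * θ 0 y.1) - ‖y.2 - u 0 y.1‖ ^ 2 / (2 * θ 0 y.1)) ∂(empiricalMeasure z)) (P N) := by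
    filter_upwards [hm₀i] with N hN
    simpa only [logProfileObs_eq_integral] using hN
  have hm₀' : Tendsto (fun N => ∫ z, (∫ y, (Real.log (ρ 0 y.1) + gChem σ (ρ 0 y.1) -
      3 / 2 * Real.log (2 * Real.pi * θ 0 y.1) - ‖y.2 - u 0 y.1‖ ^ 2 / (2 * θ 0 y.1)) ∂(empiricalMeasure z)) ∂(P N))
      atTop (nhds (∫ x, ρ 0 x * (Real.log (ρ 0 x) + gChem σ (ρ 0 x) -
        3 / 2 * Real.log (2 * Real.pi * θ 0 x) - 3 / 2))) := by
    simpa only [logProfileObs_eq_integral] using hm₀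
  have hBint : ∀ N, ∀ r ∈ Icc 0 t, Integrable (fun z => ∫ y, (Real.log (ρ r y.1) + gChem σ (ρ r y.1) -
      3 / 2 * Real.log (2 * Real.pi * θ r y.1) - ‖y.2 - u r y.1‖ ^ 2 / (2 * θ r y.1))
        ∂(empiricalMeasure ((Φ N).flow r z))) (P N) := by
    intro N r hr
    simpa only [logProfileObs_eq_integral] using (hInt N).2 r hr
  have hκ2 : 0 < κ / 2 := half_pos hκ
  have hstat : ∀ᶠ N : ℕ in atTop, ∀ r ∈ Icc 0 t,
      InformationTheory.klDiv ((Φ N).lawAt (P N) r) (particleLaw (Φ N) (canonicalDensity (Torus.geometry (Fin 3))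
        (ε N) (n N) (localGibbsProfile (fun x => ρ r x * Real.exp (gChem σ (ρ r x))) (u r) (θ r)))) ≠ ⊤ ∧
      (InformationTheory.klDiv ((Φ N).lawAt (P N) r) (particleLaw (Φ N) (canonicalDensity (Torus.geometry (Fin 3))
        (ε N) (n N) (localGibbsProfile (fun x => ρ r x * Real.exp (gChem σ (ρ r x))) (u r) (θ r))))).toReal /
          (n N : ℝ) ≤
        ((∫ x, ρ r x * (Real.log (ρ r x) + gChem σ (ρ r x) - 3 / 2 * Real.log (2 * Real.pi * θ r x) - 3 / 2)) -
          ∫ z, (∫ y, (Real.log (ρ r y.1) + gChem σ (ρ r y.1) - 3 / 2 * Real.log (2 * Real.pi * θ r y.1) -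
            ‖y.2 - u r y.1‖ ^ 2 / (2 * θ r y.1)) ∂(empiricalMeasure ((Φ N).flow r z))) ∂(P N)) + κ / 2 :=
    klDiv_div_le_of_static Φ hn (S := Icc 0 t)
      (q := fun r => localGibbsProfile (fun x => ρ r x * Real.exp (gChem σ (ρ r x))) (u r) (θ r))
      hpm hqm hp0 hq0 hZ P hPdef hP hΛA hΛB
      (mst := fun r => ∫ x, ρ r x * (Real.log (ρ r x) + gChem σ (ρ r x) -
        3 / 2 * Real.log (2 * Real.pi * θ r x) - 3 / 2))
      hπ₀ hπ hm₀i' hm₀' hBint hiso (κ / 2) hκ2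
  ------------------------------------------------------------------
  -- Step 3: PRICE (`integral_comp_flow_le_klDiv_add_log_of_nonneg` with `c = γ n`, `κ₁ = κ n / 2`)
  ------------------------------------------------------------------
  filter_upwards [hstat, hSt2 (κ / 2) hκ2, xA_mesoRadius_eventually hn] with N hNstat hNexp hNgeom r hr
  obtain ⟨hn0, hℓ0, hℓ⟩ := hNgeom
  obtain ⟨hKL, hle⟩ := hNstat r hr
  obtain ⟨hKint, hXint⟩ := hInt N
  haveI : IsProbabilityMeasure (P N) := hP N
  haveI : IsProbabilityMeasure (particleLaw (Φ N) (canonicalDensity (Torus.geometry (Fin 3)) (ε N) (n N)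
      (localGibbsProfile (fun x => ρ r x * Real.exp (gChem σ (ρ r x))) (u r) (θ r)))) :=
    xA_isProbabilityMeasure_of_klDiv_ne_top (Φ N) (P N) r (fun y => (hq0 r hr y).le) hKL
  -- the functional `G = fluctuationE ℓ_N (ρ_r, θ_r, u_r)`: measurable, nonnegative, `G ∘ Φ_r` integrable
  have hGm : Measurable fun w : Config (n N) (Fin 3) T3 => fluctuationE (mesoRadius (n N)) (ρ r) (θ r) (u r) w := by
    have hclamp : max 0 (min r t) = r := by rw [min_eq_left hr.2, max_eq_right hr.1]
    have h := (measurable_fluctuationE_clamp (n := n N) hE ht (mesoRadius (n N))).comp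
      ((measurable_const (a := r)).prodMk measurable_id)
    simpa only [Function.comp_def, hclamp, id] using h
  have hG0 : ∀ w : Config (n N) (Fin 3) T3, 0 ≤ fluctuationE (mesoRadius (n N)) (ρ r) (θ r) (u r) w := fun w =>
    fluctuationE_nonneg (mesoRadius (n N)) (ρ r) (θ r) (u r) w
  have hGi : Integrable (fun z => fluctuationE (mesoRadius (n N)) (ρ r) (θ r) (u r) ((Φ N).flow r z)) (P N) := by
    refine ((integrable_const (2 : ℝ)).add (hKint r)).mono' (hGm.comp ((Φ N).measurable_flow r)).aestronglyMeasurable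
      (Eventually.of_forall fun z => ?_)
    rw [Real.norm_eq_abs, abs_of_nonneg (hG0 _)]
    exact fluctuationE_le hn0 hℓ0 hℓ (ρ r) (θ r) (u r) ((Φ N).flow r z)
  have hnpos : (0 : ℝ) < n N := by exact_mod_cast Nat.pos_of_ne_zero hn0
  have hc : 0 < γ * (n N : ℝ) := mul_pos hγ hnpos
  have hprice := integral_comp_flow_le_klDiv_add_log_of_nonneg (Φ N) (P N)
    (particleLaw (Φ N) (canonicalDensity (Torus.geometry (Fin 3)) (ε N) (n N)
      (localGibbsProfile (fun x => ρ r x * Real.exp (gChem σ (ρ r x))) (u r) (θ r)))) r hKL hGm hG0 hGi hc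
    (hNexp r hr)
  refine ⟨hXint r hr, hGi, ?_⟩
  -- the double integral of the statics IS the expectation of the log-profile observable
  have hXeq : ∫ z, (∫ y, (Real.log (ρ r y.1) + gChem σ (ρ r y.1) - 3 / 2 * Real.log (2 * Real.pi * θ r y.1) -
      ‖y.2 - u r y.1‖ ^ 2 / (2 * θ r y.1)) ∂(empiricalMeasure ((Φ N).flow r z))) ∂(P N) =
      ∫ z, logProfileObs σ ρ θ u r ((Φ N).flow r z) ∂(P N) := by
    simp only [logProfileObs_eq_integral]
  rw [hXeq] at hle
  exact xA_price_arith hγ hnpos hle hprice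

end Summit.AtomisticToContinuum.HydrodynamicLimit.Theorems.NearConstantShortTimeHL

end
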